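import Literature.AlgebraicGeometry.Frobenioids.PadicKummerSetting
import Literature.AnabelianGeometry.EtaleTheta.BiKummerSettingUnitsKer
import Literature.AnabelianGeometry.EtaleTheta.Discharge.Sec5PushforwardGaloisOuterRep

/-!
# [EtTh] Thm 4.4 (iii) / [FrdII] Def 2.2: the Def 2.2 CONTEXT of an object of the [EtTh] hull over `B^temp(Π^tp_X)⁰`

S. Mochizuki, *The étale theta function …*, Publ. RIMS 45 (2009) [MochizukiEtTh2009], Thm 4.4 (iii) p.95 («(N, H)-saturated
… cf. [FrdII], Definition 2.2, (ii)»), §5 p.298 (the natural functor `D₀ → D^cnst = B(G_K)⁰` determined by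
`Π^tp_X ↠ G_K`); S. Mochizuki, *The geometry of Frobenioids II* [MochizukiFrdII2008], Def 2.2 (i)/(ii) p.17, Ex 1.3 (ii)
p.11, Thm 1.2 (ii) p.8.

abc-iut-w6-d047, T44-L15b E-PART §1 (census VNEXT-L2 B2 / E3): the assignment `A ↦ ctx A : PadicKummer.Def22Context`
(abc-iut-L1-d4's structure) for an object `A` of a tempered Frobenioid `tf` over `D = B^temp(Π^tp_X)⁰`, FIELD BY FIELD
from tree parts, universe `0` (the structure's fields live in `Type`):
* `AutC := Aut_C(A)`; `O := O^×(A) = ↥(tf.units A)` — commutative and normal in `Aut_C(A)` by abc-iut-w6-d047's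
  `TemperedFrobenioid.units_mul_comm` / `units_normal` ([FrdI] Thm 5.2 (ii) kernel description); `actC` = conjugation;
* `E := B(G_K)⁰`, `A_E := aug_* A^bs` along abc-iut-L3's `QuasiTemperoid.pushforward` of `aug : Π^tp_X ↠ G_K`
  ([FrdII] Ex 1.3 (ii); binder `haug : IsOpenMap aug`); `AutE := Aut(A_E)`; `res := aug_* ∘ Base` on `Aut`;
* `G := G_K`, `H` a parameter (the case of record is `H^{bs-fld}_⊙`, normal and open by abc-iut-w6-d047's
  `BiKummerThm44SubGaloisDescent`), `isGalois := «A^bs is Galois in B^temp(Π^tp_X)»`;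
* `outer :=` a representative of the outer homomorphism `G_K ↠ Aut_E(A_E)` — `Classical.choose` of abc-iut-w6-d047's
  THEOREM `CnstPushforward.exists_pushforwardOuterRep` (surjective, open kernel) in the Galois case, `1` otherwise
  (then `isGalois` is false and the context is never saturated);
* THE ONE DATUM THE TREE LACKS: the descended action `act` of `Aut_E(A_E)` on `O^×(A)` with its law `hact`
  («`res α` acts as conjugation by `α`», [FrdII] Thm 1.2 (ii) for the hull; at the genuine §5 data it descends by
  abc-iut-w5-d020's `ratFnFunctor_map_unit_eq_of_cnst`) — carried as parameters.
Definitions + their defining lemmas only; no instance, no notation.  Typed ≠ proved; nothing here bears on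
[IUTchIII] Cor 3.12.
-/

noncomputable section

namespace Literature.AnabelianGeometry.EtaleTheta

open CategoryTheory Literature.AlgebraicGeometry.Frobenioids Literature.AnabelianGeometry.SemiGraphs
  Literature.AnabelianGeometry.SemiGraphs.GaloisObjects Literature.AnabelianGeometry.EtaleTheta.CnstPushforward

namespace TemperedFrobenioid

variable {K : Type} [Field K] (X : TemperedArithmeticGroup.{0} K) {D₀ : Type} [Category.{0} D₀]
  {V : FrdIMonoidStub.{0}} {T₀ : RealifiedDivisorMonoids (D₀ := D₀) V}
  {VD : FrdICatStub.{1, 0, 0} (ConnectedPart (BTemp X.Pi))}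
  (tf : TemperedFrobenioid T₀ (ConnectedPart (BTemp X.Pi)) VD) (haug : IsOpenMap X.aug)

/-- **The base-field functor `D = B^temp(Π^tp_X)⁰ → E = B(G_K)⁰`**: push-forward along `aug : Π^tp_X ↠ G_K`
([FrdII] Ex 1.3 (ii), abc-iut-L3's `QuasiTemperoid.pushforward`; [EtTh] §5 p.298 «the natural functor `D₀ → D^cnst`»).
[cite: MochizukiFrdII2008, Ex 1.3 (ii) p.11] -/
abbrev augPush : ConnectedPart (BTemp X.Pi) ⥤ ConnectedPart (BTemp (Field.absoluteGaloisGroup K)) :=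
  QuasiTemperoid.pushforward X.aug.toMonoidHom X.aug_surjective haug

/-- **`A_E := aug_* A^bs ∈ Ob(E)`**, the image of `A` in `E = B(G_K)⁰`. [cite: MochizukiFrdII2008, Def 2.2 (i) p.17] -/
abbrev AE (A : tf.category) : ConnectedPart (BTemp (Field.absoluteGaloisGroup K)) := (augPush X haug).obj A.base

/-- **`res : Aut_C(A) → Aut_E(A_E)`**, `α ↦ aug_*(Base α)`. [cite: MochizukiFrdII2008, Def 2.2 (i) p.17] -/
abbrev resE (A : tf.category) : Aut A →* Aut (AE X tf haug A) :=
  ((augPush X haug).mapAut A.base).comp (tf.baseFunctorOfCategory.mapAut A)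

open Classical in
/-- **A representative of the outer homomorphism `G_K ↠ G_A ⊆ Aut_E(A_E)`** ([FrdII] Def 2.2 (i) «natural outer
homomorphism»): for `A^bs` Galois, the descent through `aug` of `aug_* ∘ galoisSurjOf⁰_{A^bs}` chosen from
abc-iut-w6-d047's `exists_pushforwardOuterRep`; `1` otherwise. Canonical up to an inner automorphism only (the choice of
the presentation `A^bs ≅ Π/N`). [cite: MochizukiFrdII2008, Def 2.2 (i) p.17] -/
def outerRep (A : tf.category) : Field.absoluteGaloisGroup K →* Aut (AE X tf haug A) :=
  if hA : IsGaloisObj A.base.obj then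
    Classical.choose
      (exists_pushforwardOuterRep X.aug.toMonoidHom X.aug_surjective haug X.isTempered A.base hA)
  else 1

/-- The defining properties of `outerRep` in the Galois case: it intertwines `aug_* ∘ galoisSurjOf⁰_{A^bs}` through `aug`,
is surjective, and has open kernel. [cite: MochizukiFrdII2008, Def 2.2 (i) p.17] -/
theorem outerRep_spec (A : tf.category) (hA : IsGaloisObj A.base.obj) :
    (∀ g : X.Pi, outerRep X tf haug A (X.aug g) = (augPush X haug).mapAut A.base
        (((connectedObjects (BTemp X.Pi)).fullyFaithfulι.autMulEquivOfFullyFaithful A.base).symm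
          (galoisSurjOf X.isTempered A.base.obj hA g))) ∧
      Function.Surjective (outerRep X tf haug A) ∧
      IsOpen ((outerRep X tf haug A).ker : Set (Field.absoluteGaloisGroup K)) := by
  rw [outerRep, dif_pos hA]
  exact Classical.choose_spec
    (exists_pushforwardOuterRep X.aug.toMonoidHom X.aug_surjective haug X.isTempered A.base hA)

/-- `outerRep` intertwines `aug_* ∘ galoisSurjOf⁰_{A^bs}` through `aug` (Galois case).
[cite: MochizukiFrdII2008, Def 2.2 (i) p.17] -/
theorem outerRep_aug (A : tf.category) (hA : IsGaloisObj A.base.obj) (g : X.Pi) :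
    outerRep X tf haug A (X.aug g) = (augPush X haug).mapAut A.base
      (((connectedObjects (BTemp X.Pi)).fullyFaithfulι.autMulEquivOfFullyFaithful A.base).symm
        (galoisSurjOf X.isTempered A.base.obj hA g)) :=
  (outerRep_spec X tf haug A hA).1 g

/-- `outerRep` is the trivial homomorphism when `A^bs` is not Galois. [cite: MochizukiFrdII2008, Def 2.2 (i) p.17] -/
theorem outerRep_of_not_isGaloisObj (A : tf.category) (hA : ¬ IsGaloisObj A.base.obj) : outerRep X tf haug A = 1 := by
  rw [outerRep, dif_neg hA]

/-- **The [FrdII] Def 2.2 CONTEXT of `A ∈ Ob(C)`** for the tempered Frobenioid `tf` over `B^temp(Π^tp_X)⁰` with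
`E`-images along `aug_*`: `AutC := Aut_C(A)`, `O := O^×(A)` (conjugation action), `AutE := Aut(aug_* A^bs)`,
`res := aug_* ∘ Base`, `G := G_K`, `H` (parameter), `isGalois := «A^bs Galois»`, `outer := outerRep`.  DATA CARRIED:
the descended action `act` of `Aut_E(A_E)` on `O^×(A)` and its law `hact` (`res α • u = α u α⁻¹`, [FrdII] Thm 1.2 (ii)
for the hull). [cite: MochizukiFrdII2008, Def 2.2 (i) p.17] -/
def def22Ctx (A : tf.category)
    (act : MulDistribMulAction (Aut (AE X tf haug A)) ↥(tf.units A))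
    (hact : ∀ (α : Aut A) (u : ↥(tf.units A)), (resE X tf haug A α) • u =
      (⟨α * u.1 * α⁻¹, (tf.units_normal A).conj_mem _ u.2 α⟩ : ↥(tf.units A)))
    (H : Subgroup (Field.absoluteGaloisGroup K)) (hHn : H.Normal)
    (hH : IsOpen (H : Set (Field.absoluteGaloisGroup K))) :
    PadicKummer.Def22Context :=
  letI : CommGroup ↥(tf.units A) := { mul_comm := fun u v => Subtype.ext (tf.units_mul_comm A u.2 v.2) }
  haveI : (tf.units A).Normal := tf.units_normal A
  { AutC := Aut A
    O := ↥(tf.units A)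
    actC := MulDistribMulAction.compHom _ (MulAut.conjNormal (H := tf.units A))
    AutE := Aut (AE X tf haug A)
    res := resE X tf haug A
    res_smul := fun α u => by
      rw [hact]
      exact Subtype.ext (MulAut.conjNormal_apply (H := tf.units A) α u).symm
    G := Field.absoluteGaloisGroup K
    H := H
    normalH := hHn
    isOpen_H := hH
    isGalois := IsGaloisObj A.base.obj
    outer := outerRep X tf haug A
    outer_surjective := fun hA => (outerRep_spec X tf haug A hA).2.1
    isOpen_ker_outer := by
      by_cases hA : IsGaloisObj A.base.obj
      · exact (outerRep_spec X tf haug A hA).2.2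
      · rw [outerRep_of_not_isGaloisObj X tf haug A hA, MonoidHom.ker_one]
        exact isOpen_univ }

/-! ### The fields, definitionally -/

section Fields

variable (A : tf.category) (act : MulDistribMulAction (Aut (AE X tf haug A)) ↥(tf.units A))
  (hact : ∀ (α : Aut A) (u : ↥(tf.units A)), (resE X tf haug A α) • u =
    (⟨α * u.1 * α⁻¹, (tf.units_normal A).conj_mem _ u.2 α⟩ : ↥(tf.units A)))
  (H : Subgroup (Field.absoluteGaloisGroup K)) (hHn : H.Normal) (hH : IsOpen (H : Set (Field.absoluteGaloisGroup K)))

/-- `(ctx A).G = G_K`. [cite: MochizukiFrdII2008, Def 2.2 (i) p.17] -/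
theorem def22Ctx_G : (def22Ctx X tf haug A act hact H hHn hH).G = Field.absoluteGaloisGroup K := rfl

/-- `(ctx A).H = H`. [cite: MochizukiFrdII2008, Def 2.2 (i) p.17] -/
theorem def22Ctx_H : (def22Ctx X tf haug A act hact H hHn hH).H = H := rfl

/-- `(ctx A).isGalois ↔ A^bs Galois`. [cite: MochizukiFrdII2008, Def 2.2 (i) p.17] -/
theorem def22Ctx_isGalois : (def22Ctx X tf haug A act hact H hHn hH).isGalois ↔ IsGaloisObj A.base.obj := Iff.rfl

/-- `(ctx A).outer = outerRep A`. [cite: MochizukiFrdII2008, Def 2.2 (i) p.17] -/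
theorem def22Ctx_outer : (def22Ctx X tf haug A act hact H hHn hH).outer = outerRep X tf haug A := rfl

/-- `(ctx A).res = aug_* ∘ Base`. [cite: MochizukiFrdII2008, Def 2.2 (i) p.17] -/
theorem def22Ctx_res : (def22Ctx X tf haug A act hact H hHn hH).res = resE X tf haug A := rfl

end Fields

end TemperedFrobenioid

end Literature.AnabelianGeometry.EtaleTheta

end
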